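import Summits.QuantumFields.QCD.Theses.WilsonMobilityGap
import Summits.QuantumFields.QCD.Theorems.MobilityGap.Negative.LowerPin
import Literature.MathematicalPhysics.QuantumFieldTheory.QCDPhaseQuenchedPositivity

/-!
# Disproof of `ChiralMobilityGap` — findings (crux stmt-QuantumFields-17497, route WilsonMobilityGap)

Standing disprover's work file (refuter-cdisprove-stmt-QuantumFields-17497-0, cycle 1, 2026-08-17).
Prose lives in docstrings; every `theorem` without `sorry` is kernel-checked (`lean check` rc 0).
`ChiralMobilityGap` = the support crux `MobilityGap` (stmt-9150) with the pin `reg.IsChiralAtZero ∧`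
inserted, so EVERYTHING in `Cruxes/MobilityGap/Disproof.lean` and the landed
`Theorems/MobilityGap/Negative/LowerPin.lean` (imported here: clause abbreviations `ClauseI`/`Upper`/
`Lower`/`Sign`/`Clauses`, `no_rate_sandwich`, the bare-mass window of (iii), `heavyReg`,
`mobilityGapWithoutLower_holds`) transfers verbatim (`not_chiralMobilityGap_of_not_mobilityGap`).
This file adds the analysis of the NEW load-bearing hypothesis, the pin (v) `IsChiralAtZero`.
LANDED EXTRACT (sorry-free, def-free): `Theorems/ChiralMobilityGap/Negative/PinShift.lean`
(proposal p134858, `--supports stmt-QuantumFields-17497`), namespace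
`Summit.QuantumFields.QCD.Theorems.ChiralMobilityGap.Negative` — §0–§2 below minus the `def`s, with
the shift written as the explicit structure literal and the already-landed pieces REUSED instead of
restated: `ChiralDescent.Negative.hasLatticeMassGap_mono` (FlavourGuard.lean),
`GluonicCompletion.Negative.scheme_mcrit_shift` (Threshold.lean),
`RobustYangMillsHandover.Negative.hasMassScaling_mcrit_shift_iff` / `isChiralAtZero_mcrit_shift_iff` /
`not_isChiralAtZero_mcrit_shift_of_uniformGapAbove` (ChiralityObstruction.lean).  Importers should use
those names; the `shiftReg` abbreviation below is local to this workfile.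

## Index

* §0 `chiralMobilityGap_iff` (definitional re-read), `not_chiralMobilityGap_of_not_mobilityGap`,
  `chiralMobilityGap_witness_window` — transfer of the (iii)-window to every pinned witness.
* §1 PIN ALGEBRA (all sorry-free): `hasLatticeMassGap_mono`, `isChiralAtZero_iff_small` (only small
  `ε` matter); the offset shift `shiftReg` with `shiftReg_scheme` / `clauses_shiftReg` (the UNPINNED
  package is invariant under every upward shift of `m_crit`) and `not_isChiralAtZero_shiftReg` (a gap
  above `M₀` kills the chirality of the `M₀`-shifted regularisation) — hence
  `exists_clauses_not_chiral_of_gappedWitness`: as soon as ONE gapped package witness exists, package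
  witnesses that are NOT chiral exist, so the free-standing split "∀ reg, package → pin" is false and the
  pin can only be proved about the prover's OWN witness (route text, NOT DECOMPOSED YET, made precise);
  `isChiralAtZero_of_equalTime_unbounded` — SOFTNESS: one mass tuple with unbounded equal-time
  connected correlations (a blow-up of the signed normalisation `∫ det dμ_W` at some `S > L_k`, which
  clause (iv) does not police) already makes `reg` "chiral at zero" for every `ε`; and
  `isChiralAtZero_of_frequently` — the pin is a `liminf`/frequently-in-`k` condition.
* §2 (iv) ON THE DIAGONAL: `det_diracMatrix_two_degenerate_eq_norm`, `sign_two_degenerate` — for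
  `N_f = 2` and a DEGENERATE tuple `t·(1,1)` the Wilson weight is `det² ≥ 0`, so clause (iv) holds with
  ratio exactly `1` at every `t` (also supercritical), every `β`, every side: the `N_f = 2` content of
  (iv) sits entirely in SPLIT tuples; for `N_f = 3` there is no parity cancellation.
* §3 LOAD MAP of the pinned crux: `ChiralMobilityGapWithoutPin ↔ MobilityGap`
  (`withoutPin_iff_mobilityGap`); `ChiralMobilityGapWithoutLower` is NO LONGER cheaply inhabited — the
  lattice-heavy `heavyReg` carries (i), (ii), (iv) and both scalings (`mobilityGapWithoutLower_holds`)
  but its pin is undecidable here either way (near-miss `heavyReg_not_chiral`, sorried: needs the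
  Yang–Mills-hard clustering of gluonic observables at `β_k → ∞`).
* §4 Natural strengthenings: transferred (`no k-uniform lattice rate`); tried and not refutable here:
  `m`-uniform (ii), the pin along every subsequence, (iv) at all volumes.
* §5 Line `Sketch` (lead's PICKED line, card `pin-rides-on-lower-clause`): adversarial reading of its two
  first lemmas — both sound; the pin for `N_f = 2` is the small-`t` asymptotics `C₁(t)/s(t) → 0` of the
  (iii) constants on the diagonal (where §2 says the signed functional is a positive-weight one).
* §6 WHY IT RESISTS: the early-crosser arithmetic behind (iv) with the pin in place, the absence of any
  configuration-wise or finite-computation handle, literature (no printed counterexample).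
-/

noncomputable section

namespace Summit.QuantumFields.QCD.Cruxes.ChiralMobilityGap.Disproof

open scoped BigOperators Topology
open MeasureTheory Filter Set
open Literature.MathematicalPhysics.QuantumFieldTheory Literature.MathematicalPhysics.QuantumLattice
  Literature.Probability.LatticeModels
open Summit.QuantumFields.QCD.Theorems.MobilityGapNegative

local notation "𝔾₃" => Matrix.specialUnitaryGroup (Fin 3) ℂ

variable {Nf : ℕ}

/-! ### §0 The pinned crux, re-read (definitional) and its transfer to `MobilityGap`

Reading notes (probe `W.lean`, rc 0, one `sorry` warning): the text is MobilityGap's with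
`reg.IsChiralAtZero ∧` inserted after `reg.HasMassScaling ∧`; all reading notes of LowerPin §0 apply
(sup norm `‖v‖∞` on `Site 4 = Fin 4 → ℤ`, positive denominators `∫ |det| > 0` at every parameter,
bounded integrands, `D⁻¹ := 0` at singular `D` carries weight `0`, `∃ reg` before `∀ m`, independent
`s` in (ii)/(iii), (iv) only at side `2L_k+1`).  The pin unfolds to
`∀ ε > 0, ∃ m, (∀ f, 0 < m f) ∧ ¬ (reg.scheme m 0 0).HasLatticeMassGap ε` (`Iff.rfl`), a statement
about the SIGNED functional `qcdTorusExpect` (time-periodic `(−1)^F`-twisted trace) of ALL pairs of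
gauge-invariant local observables, negated: some pair fails the rate-`ε` bound FREQUENTLY in `k` at
SOME admissible volume `S ≥ L_k` and separation `n ≤ S`.
-/

/-- The per-regularisation body of the pinned crux: both scalings, the pin, and (i)–(iv) for all
positive tuples.  Statement abbreviation for the analysis (verbatim the body of the Theses decl,
`chiralMobilityGap_iff` is `Iff.rfl`), not a fact. [folklore] -/
def PinnedClauses (Nf : ℕ) (reg : QCDRegularisation Nf) : Prop :=
  reg.HasMassScaling ∧ reg.IsChiralAtZero ∧ (reg.scheme 0 0 0).HasAsymptoticScaling ∧
    ∀ m : Fin Nf → ℝ, (∀ f, 0 < m f) → ClauseI reg m ∧ Upper reg m ∧ Lower reg m ∧ Sign reg m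

/-- The pinned crux, re-read clause by clause (definitional). -/
theorem chiralMobilityGap_iff :
    Summit.QuantumFields.QCD.Theses.WilsonMobilityGap.ChiralMobilityGap ↔
      ∀ Nf : ℕ, Nf = 2 ∨ Nf = 3 → ∃ reg : QCDRegularisation Nf, PinnedClauses Nf reg :=
  Iff.rfl

/-- `PinnedClauses = Clauses ∧ pin` (reordering of conjuncts). -/
theorem pinnedClauses_iff (reg : QCDRegularisation Nf) :
    PinnedClauses Nf reg ↔ Clauses Nf reg ∧ reg.IsChiralAtZero := by
  unfold PinnedClauses Clauses
  tauto

/-- **The pinned crux implies the unpinned support crux** (drop the pin), stated as the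
contrapositive — the shape a refutation via the support crux would take: every negative result on
`MobilityGap` refutes `ChiralMobilityGap` a fortiori, and every lemma banked on a witness transfers.
(The positive implication `ChiralMobilityGap → MobilityGap` is the planner's one-liner
`mobilityGap_of_chiralMobilityGap`; it is not restated here so that no theorem of this file has a
Theses decl as its conclusion.) -/
theorem not_chiralMobilityGap_of_not_mobilityGap
    (h : ¬ Summit.QuantumFields.QCD.Theses.WilsonMobilityGap.MobilityGap) :
    ¬ Summit.QuantumFields.QCD.Theses.WilsonMobilityGap.ChiralMobilityGap := by
  intro hc
  refine h fun Nf hNf => ?_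
  obtain ⟨reg, h1, -, h3, h4⟩ := hc Nf hNf
  exact ⟨reg, h1, h3, h4⟩

/-- **Transfer of the (iii)-window.** Every witness of the pinned crux realises, for every positive
mass tuple, bare trajectories eventually inside `|m_f(k) + 4| < 41/10` with `m_crit(k) < 1/10`
eventually (LowerPin §2: clause (iii) alone excludes the convergent hopping region). -/
theorem chiralMobilityGap_witness_window
    (h : Summit.QuantumFields.QCD.Theses.WilsonMobilityGap.ChiralMobilityGap) :
    ∀ Nf : ℕ, Nf = 2 ∨ Nf = 3 → ∃ reg : QCDRegularisation Nf, PinnedClauses Nf reg ∧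
      ∀ m : Fin Nf → ℝ, (∀ f, 0 < m f) → ∀ f : Fin Nf,
        (∀ᶠ k in atTop, |reg.mcrit k + reg.a k * m f / reg.Zm k + 4| < 41 / 10) ∧
        (∀ᶠ k in atTop, reg.mcrit k < 1 / 10) := by
  intro Nf hNf
  obtain ⟨reg, hreg⟩ := chiralMobilityGap_iff.1 h Nf hNf
  exact ⟨reg, hreg, fun m hm f =>
    ⟨eventually_window_of_lower reg m (hreg.2.2.2 m hm).2.2.1 f,
     eventually_mcrit_lt_of_lower reg m hm (hreg.2.2.2 m hm).2.2.1 f⟩⟩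

/-! ### §1 Pin algebra: monotonicity, the offset shift, softness -/

/-- **Monotonicity of the lattice gap in `Δ`.**  A uniform gap `Δ` is a uniform gap `Δ'` for every
`Δ' ≤ Δ` (constants `max C 0`). -/
theorem hasLatticeMassGap_mono (sch : QCDScheme Nf) {Δ Δ' : ℝ} (hle : Δ' ≤ Δ)
    (h : sch.HasLatticeMassGap Δ) : sch.HasLatticeMassGap Δ' := by
  intro R R' A B
  obtain ⟨C, hC⟩ := h R R' A B
  refine ⟨max C 0, ?_⟩
  filter_upwards [hC] with k hk S hS n hn
  refine (hk S hS n hn).trans ?_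
  have hexp : Real.exp (-(Δ * (sch.a k * n))) ≤ Real.exp (-(Δ' * (sch.a k * n))) := by
    apply Real.exp_le_exp.2
    have : 0 ≤ sch.a k * n := mul_nonneg (sch.a_pos k).le (Nat.cast_nonneg n)
    nlinarith
  calc C * Real.exp (-(Δ * (sch.a k * n)))
      ≤ max C 0 * Real.exp (-(Δ * (sch.a k * n))) :=
        mul_le_mul_of_nonneg_right (le_max_left _ _) (Real.exp_pos _).le
    _ ≤ max C 0 * Real.exp (-(Δ' * (sch.a k * n))) :=
        mul_le_mul_of_nonneg_left hexp (le_max_right _ _)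

/-- **Only small `ε` matter in the pin**: for any `ε₀ > 0`, `IsChiralAtZero` is equivalent to its
restriction to `ε < ε₀` (gaplessness at rate `ε` is inherited by every larger rate). -/
theorem isChiralAtZero_iff_small (reg : QCDRegularisation Nf) {ε₀ : ℝ} (hε₀ : 0 < ε₀) :
    reg.IsChiralAtZero ↔
      ∀ ε : ℝ, 0 < ε → ε < ε₀ → ∃ m : Fin Nf → ℝ, (∀ f, 0 < m f) ∧
        ¬ (reg.scheme m 0 0).HasLatticeMassGap ε := by
  constructor
  · exact fun h ε hε _ => h ε hε
  · intro h ε hε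
    obtain ⟨m, hm, hng⟩ := h (min ε (ε₀ / 2)) (lt_min hε (by linarith))
      (lt_of_le_of_lt (min_le_right _ _) (by linarith))
    exact ⟨m, hm, fun hg => hng (hasLatticeMassGap_mono _ (min_le_left _ _) hg)⟩

/-- **The offset shift of the flavour-blind critical mass**: `m_crit(k) ↦ m_crit(k) + a_k M₀/Z_m(k)`
(all other data unchanged).  The symmetry behind `qcdOf_iff_threshold` (pre-re-type `QCDOf`). -/
def shiftReg (reg : QCDRegularisation Nf) (M₀ : ℝ) : QCDRegularisation Nf :=
  { reg with mcrit := fun k => reg.mcrit k + reg.a k * M₀ / reg.Zm k }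

/-- The shift keeps the spacings. [folklore] -/
@[simp] theorem shiftReg_a (reg : QCDRegularisation Nf) (M₀ : ℝ) : (shiftReg reg M₀).a = reg.a := rfl

/-- The shift keeps the couplings. [folklore] -/
@[simp] theorem shiftReg_β (reg : QCDRegularisation Nf) (M₀ : ℝ) : (shiftReg reg M₀).β = reg.β := rfl

/-- The shift keeps the volumes. [folklore] -/
@[simp] theorem shiftReg_L (reg : QCDRegularisation Nf) (M₀ : ℝ) : (shiftReg reg M₀).L = reg.L := rfl

/-- The shift keeps the mass renormalisation. [folklore] -/
@[simp] theorem shiftReg_Zm (reg : QCDRegularisation Nf) (M₀ : ℝ) : (shiftReg reg M₀).Zm = reg.Zm := rfl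

/-- The shifted critical mass. [folklore] -/
@[simp] theorem shiftReg_mcrit (reg : QCDRegularisation Nf) (M₀ : ℝ) (k : ℕ) :
    (shiftReg reg M₀).mcrit k = reg.mcrit k + reg.a k * M₀ / reg.Zm k := rfl

/-- Running the shifted regularisation at masses `m` is running the original at `M₀ + m`. -/
theorem shiftReg_scheme (reg : QCDRegularisation Nf) (M₀ : ℝ) (m : Fin Nf → ℝ)
    (z shift : QCDField Nf → ℕ → ℝ) :
    (shiftReg reg M₀).scheme m z shift = reg.scheme (fun f => M₀ + m f) z shift := by
  simp only [shiftReg, QCDRegularisation.scheme, QCDScheme.mk.injEq, true_and, and_true]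
  funext f k
  ring

/-- The realised bare tuples of the shifted regularisation. -/
theorem bare_shiftReg (reg : QCDRegularisation Nf) (M₀ : ℝ) (m : Fin Nf → ℝ) (k : ℕ) :
    bare (shiftReg reg M₀) m k = bare reg (fun f => M₀ + m f) k := by
  funext f
  simp only [bare, shiftReg]
  ring

/-- The shift does not touch `HasMassScaling` (which reads `a`, `Z_m` only). -/
theorem hasMassScaling_shiftReg (reg : QCDRegularisation Nf) (M₀ : ℝ) :
    (shiftReg reg M₀).HasMassScaling ↔ reg.HasMassScaling := Iff.rfl

/-- Nor asymptotic scaling (which reads `β`, `a` only). -/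
theorem hasAsymptoticScaling_shiftReg (reg : QCDRegularisation Nf) (M₀ : ℝ) :
    ((shiftReg reg M₀).scheme 0 0 0).HasAsymptoticScaling ↔ (reg.scheme 0 0 0).HasAsymptoticScaling :=
  Iff.rfl

/-- Clause (i) of the shifted regularisation at `m` is clause (i) of the original at `M₀ + m`. -/
theorem clauseI_shiftReg (reg : QCDRegularisation Nf) (M₀ : ℝ) (m : Fin Nf → ℝ) :
    ClauseI (shiftReg reg M₀) m ↔ ClauseI reg (fun f => M₀ + m f) := by
  have h : ∀ (f : Fin Nf) (k : ℕ), (shiftReg reg M₀).mcrit k + (shiftReg reg M₀).a k * m f /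
      (shiftReg reg M₀).Zm k = reg.mcrit k + reg.a k * (M₀ + m f) / reg.Zm k := by
    intro f k; simp only [shiftReg]; ring
  simp only [ClauseI, h]

/-- Clause (ii) likewise. -/
theorem upper_shiftReg (reg : QCDRegularisation Nf) (M₀ : ℝ) (m : Fin Nf → ℝ) :
    Upper (shiftReg reg M₀) m ↔ Upper reg (fun f => M₀ + m f) := by
  simp only [Upper, bare_shiftReg, shiftReg_a, shiftReg_β, shiftReg_L]

/-- Clause (iii) likewise. -/
theorem lower_shiftReg (reg : QCDRegularisation Nf) (M₀ : ℝ) (m : Fin Nf → ℝ) :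
    Lower (shiftReg reg M₀) m ↔ Lower reg (fun f => M₀ + m f) := by
  simp only [Lower, bare_shiftReg, shiftReg_a, shiftReg_β, shiftReg_L]

/-- Clause (iv) likewise. -/
theorem sign_shiftReg (reg : QCDRegularisation Nf) (M₀ : ℝ) (m : Fin Nf → ℝ) :
    Sign (shiftReg reg M₀) m ↔ Sign reg (fun f => M₀ + m f) := by
  have h : ∀ k, bare (shiftReg reg M₀) m k = bare reg (fun f => M₀ + m f) k := bare_shiftReg reg M₀ m
  unfold Sign
  simp only [h]
  exact Iff.rfl

/-- **The UNPINNED package is invariant under every upward shift** `M₀ ≥ 0`: positive tuples of the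
shifted regularisation are positive tuples `> M₀` of the original. -/
theorem clauses_shiftReg {reg : QCDRegularisation Nf} (h : Clauses Nf reg) {M₀ : ℝ} (hM : 0 ≤ M₀) :
    Clauses Nf (shiftReg reg M₀) := by
  refine ⟨(hasMassScaling_shiftReg reg M₀).2 h.1, (hasAsymptoticScaling_shiftReg reg M₀).2 h.2.1,
    fun m hm => ?_⟩
  have hm' : ∀ f, 0 < M₀ + m f := fun f => by linarith [hm f]
  obtain ⟨h1, h2, h3, h4⟩ := h.2.2 _ hm'
  exact ⟨(clauseI_shiftReg reg M₀ m).2 h1, (upper_shiftReg reg M₀ m).2 h2,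
    (lower_shiftReg reg M₀ m).2 h3, (sign_shiftReg reg M₀ m).2 h4⟩

/-- **The pin is NOT shift-invariant: a uniform gap above `M₀` kills the chirality of the
`M₀`-shifted regularisation.**  This is the precise sense in which `IsChiralAtZero` pins the
flavour-blind offset: the offset family `shiftReg reg M₀`, `M₀ > 0`, of a gapped witness — the family
that made the pre-re-type `QCDOf` equivalent to its threshold reading — fails the pin. -/
theorem not_isChiralAtZero_shiftReg {reg : QCDRegularisation Nf} {M₀ ε : ℝ} (hε : 0 < ε)
    (hgap : ∀ m : Fin Nf → ℝ, (∀ f, M₀ < m f) → (reg.scheme m 0 0).HasLatticeMassGap ε) :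
    ¬ (shiftReg reg M₀).IsChiralAtZero := by
  intro h
  obtain ⟨m, hm, hng⟩ := h ε hε
  rw [shiftReg_scheme] at hng
  exact hng (hgap _ fun f => by linarith [hm f])

/-- **Refuted free-standing split (modulo a gapped witness).**  If ONE regularisation carries the
unpinned package together with a uniform lattice gap `ε` at all positive tuples (what any proof of the
old `QCDOf`/`MobilityGap` milestone "above the offset" produces), then there is a regularisation
carrying the unpinned package which is NOT chiral at zero — so `∀ reg, Clauses reg → reg.IsChiralAtZero`
(the pin as an independent item over arbitrary witnesses) is FALSE, and the pin can only be an
obligation on the prover's own `∃`-witness (route text "EdgeGaplessness … cannot be split off"). -/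
theorem exists_clauses_not_chiral_of_gappedWitness
    (hex : ∃ reg : QCDRegularisation Nf, Clauses Nf reg ∧
      ∃ ε > (0 : ℝ), ∀ m : Fin Nf → ℝ, (∀ f, 0 < m f) → (reg.scheme m 0 0).HasLatticeMassGap ε) :
    ∃ reg : QCDRegularisation Nf, Clauses Nf reg ∧ ¬ reg.IsChiralAtZero := by
  obtain ⟨reg, hC, ε, hε, hgap⟩ := hex
  exact ⟨shiftReg reg 1, clauses_shiftReg hC zero_le_one,
    not_isChiralAtZero_shiftReg hε fun m hm => hgap m fun f => by linarith [hm f]⟩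

/-- The same, as the negation of the free-standing implication. -/
theorem not_forall_clauses_imp_chiral_of_gappedWitness
    (hex : ∃ reg : QCDRegularisation Nf, Clauses Nf reg ∧
      ∃ ε > (0 : ℝ), ∀ m : Fin Nf → ℝ, (∀ f, 0 < m f) → (reg.scheme m 0 0).HasLatticeMassGap ε) :
    ¬ ∀ reg : QCDRegularisation Nf, Clauses Nf reg → reg.IsChiralAtZero := by
  intro hall
  obtain ⟨reg, hC, hnc⟩ := exists_clauses_not_chiral_of_gappedWitness hex
  exact hnc (hall reg hC)

/-- **Softness of the pin (equal-time blow-up).**  If at ONE positive mass tuple some pair of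
observables has UNBOUNDED equal-time connected correlation along the regularisation — frequently in `k`,
at some admissible volume `S ≥ L_k` — then `reg` is chiral at zero for EVERY `ε`: the separation `n = 0`
of `HasLatticeMassGap` kills the rate.  Such a blow-up is a sign-problem artefact of the signed
normalisation `∫ det dμ_W` at volumes `S > L_k`, which clause (iv) (stated at side `2L_k+1` only) does not
police; physically it does not happen, but the pin as typed does not exclude being met this way. -/
theorem isChiralAtZero_of_equalTime_unbounded (reg : QCDRegularisation Nf)
    (h : ∃ m : Fin Nf → ℝ, (∀ f, 0 < m f) ∧ ∃ (R R' : ℕ) (A : QCDLatticeObservable Nf R)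
      (B : QCDLatticeObservable Nf R'), ∀ C : ℝ, ∃ᶠ k in atTop, ∃ S : ℕ, reg.L k ≤ S ∧
        C < ‖qcdLatticeConnectedCorr (reg.β k) (2 * S + 1)
          (fun fl => reg.mcrit k + reg.a k * m fl / reg.Zm k) A B 0‖) :
    reg.IsChiralAtZero := by
  intro ε _
  obtain ⟨m, hm, R, R', A, B, hAB⟩ := h
  refine ⟨m, hm, fun hgap => ?_⟩
  obtain ⟨C, hC⟩ := hgap R R' A B
  obtain ⟨k, ⟨S, hS, hlt⟩, hk⟩ := ((hAB C).and_eventually hC).exists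
  have h0 := hk S hS 0 (Nat.zero_le S)
  simp only [QCDRegularisation.scheme, Nat.cast_zero, mul_zero, neg_zero, Real.exp_zero,
    mul_one] at h0
  exact absurd (lt_of_lt_of_le hlt h0) (lt_irrefl C)

/-- **The pin is a `liminf` condition**: it is implied by gaplessness witnessed along ANY set of `k`
that is merely cofinal — e.g. if for every `ε` some positive tuple has an observable pair whose
correlation beats `C e^{-ε a_k n}` for infinitely many `k` (at some `S ≥ L_k`, `n ≤ S`).  (This is
just the negation of `∃ C, ∀ᶠ k, …` unfolded; recorded because it means the pin constrains the
offset of `m_crit(k)` only along a subsequence, cf. `QCDGoldstoneBound`'s remark that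
`IsChiralAtZero` is not inherited by subsequences.) -/
theorem isChiralAtZero_of_frequently (reg : QCDRegularisation Nf)
    (h : ∀ ε > (0 : ℝ), ∃ m : Fin Nf → ℝ, (∀ f, 0 < m f) ∧ ∃ (R R' : ℕ)
      (A : QCDLatticeObservable Nf R) (B : QCDLatticeObservable Nf R'), ∀ C : ℝ,
        ∃ᶠ k in atTop, ∃ S : ℕ, reg.L k ≤ S ∧ ∃ n : ℕ, n ≤ S ∧
          C * Real.exp (-(ε * (reg.a k * n))) <
            ‖qcdLatticeConnectedCorr (reg.β k) (2 * S + 1)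
              (fun fl => reg.mcrit k + reg.a k * m fl / reg.Zm k) A B n‖) :
    reg.IsChiralAtZero := by
  intro ε hε
  obtain ⟨m, hm, R, R', A, B, hAB⟩ := h ε hε
  refine ⟨m, hm, fun hgap => ?_⟩
  obtain ⟨C, hC⟩ := hgap R R' A B
  obtain ⟨k, ⟨S, hS, n, hn, hlt⟩, hk⟩ := ((hAB C).and_eventually hC).exists
  exact absurd (hk S hS n hn) (not_le.2 hlt)

/-- Conversely the pin unfolds to exactly that frequently-in-`k` form. -/
theorem isChiralAtZero_iff_frequently (reg : QCDRegularisation Nf) :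
    reg.IsChiralAtZero ↔
      ∀ ε > (0 : ℝ), ∃ m : Fin Nf → ℝ, (∀ f, 0 < m f) ∧ ∃ (R R' : ℕ)
        (A : QCDLatticeObservable Nf R) (B : QCDLatticeObservable Nf R'), ∀ C : ℝ,
          ∃ᶠ k in atTop, ∃ S : ℕ, reg.L k ≤ S ∧ ∃ n : ℕ, n ≤ S ∧
            C * Real.exp (-(ε * (reg.a k * n))) <
              ‖qcdLatticeConnectedCorr (reg.β k) (2 * S + 1)
                (fun fl => reg.mcrit k + reg.a k * m fl / reg.Zm k) A B n‖ := by
  refine ⟨fun h ε hε => ?_, isChiralAtZero_of_frequently reg⟩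
  obtain ⟨m, hm, hng⟩ := h ε hε
  refine ⟨m, hm, ?_⟩
  by_contra hcon
  apply hng
  intro R R' A B
  by_contra hC
  apply hcon
  refine ⟨R, R', A, B, fun C => ?_⟩
  rw [not_exists] at hC
  have hC' := hC C
  rw [not_eventually] at hC'
  refine hC'.mono fun k hk => ?_
  simp only [not_forall, not_le, exists_prop] at hk
  obtain ⟨S, hS, n, hn, hlt⟩ := hk
  exact ⟨S, hS, n, hn, hlt⟩

/-! ### §2 Clause (iv) on the diagonal of the `N_f = 2` mass plane is automatic -/

/-- For two DEGENERATE flavours the Wilson weight is the non-negative real `det D_W(t)²`, at every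
gauge field and every bare mass `t` (supercritical included): `det = ‖det‖`. -/
theorem det_diracMatrix_two_degenerate_eq_norm {S : ℕ} [NeZero S] (U : GaugeConfig 4 S 𝔾₃)
    (t : ℝ) :
    (diracMatrix U (fun _ : Fin 2 => t)).det =
      ((‖(diracMatrix U (fun _ : Fin 2 => t)).det‖ : ℝ) : ℂ) := by
  set d : ℂ := fermionDet (wilsonDirac (fundamentalRep (Fin 3)) U t 1) with hd
  have him : d.im = 0 := by
    simpa [hd] using fermionDet_wilsonDirac_im_holds (L := S) (fundamentalRep (Fin 3))
      (fun g => fundamentalRep_mem_unitaryGroup g) U t 1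
  have hdre : d = ((d.re : ℝ) : ℂ) := Complex.ext (by simp) (by simp [him])
  have hdet : (diracMatrix U (fun _ : Fin 2 => t)).det = ((d.re ^ 2 : ℝ) : ℂ) := by
    rw [det_diracMatrix, Fin.prod_univ_two]
    show d * d = ((d.re ^ 2 : ℝ) : ℂ)
    conv_lhs => rw [hdre]
    push_cast
    ring
  rw [hdet, Complex.norm_real, Real.norm_eq_abs, abs_of_nonneg (sq_nonneg _)]

/-- Hence the sign-coherence ratio is exactly `1` on the diagonal, at every coupling and side. -/
theorem signRatio_eq_one_two_degenerate {S : ℕ} [NeZero S] (β t : ℝ) :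
    ‖∫ U : GaugeConfig 4 S 𝔾₃, (diracMatrix U (fun _ : Fin 2 => t)).det
        ∂(wilsonMeasure (fundamentalRep (Fin 3)) β)‖ /
      (∫ U : GaugeConfig 4 S 𝔾₃, ‖(diracMatrix U (fun _ : Fin 2 => t)).det‖
        ∂(wilsonMeasure (fundamentalRep (Fin 3)) β)) = 1 := by
  have hZ := integral_norm_det_diracMatrix_pos_all (S := S) β (fun _ : Fin 2 => t)
  have hI : ∫ U : GaugeConfig 4 S 𝔾₃, (diracMatrix U (fun _ : Fin 2 => t)).det
        ∂(wilsonMeasure (fundamentalRep (Fin 3)) β) =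
      ∫ U : GaugeConfig 4 S 𝔾₃, ((‖(diracMatrix U (fun _ : Fin 2 => t)).det‖ : ℝ) : ℂ)
        ∂(wilsonMeasure (fundamentalRep (Fin 3)) β) :=
    integral_congr_ae (Eventually.of_forall fun U => det_diracMatrix_two_degenerate_eq_norm U t)
  rw [hI, integral_complex_ofReal, Complex.norm_real, Real.norm_eq_abs, abs_of_pos hZ, div_self hZ.ne']

/-- **Clause (iv) is void on the diagonal for `N_f = 2`**: along ANY regularisation, the degenerate
tuple `(t, t)` realises the degenerate bare tuple `(m_crit(k) + a_k t/Z_m(k)) · (1,1)`, whose sign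
ratio is `1 ≥ 1/2` at every `k` — for every real `t`, positive or not.  So for `N_f = 2` the content of
(iv) lies entirely in SPLIT tuples `t₁ ≠ t₂` (real modes of `D_W(U,0,1)` in the window between the two
bare masses; barrier `WilsonDeterminantMassSplitting`), while for `N_f = 3` (`det³`) no parity
cancellation exists at any tuple.  The pin, which quantifies `∃ m`, may therefore be discharged for
`N_f = 2` on the diagonal, where the signed functional is a positive-weight expectation. -/
theorem sign_two_degenerate (reg : QCDRegularisation 2) (t : ℝ) : Sign reg (fun _ => t) :=
  Eventually.of_forall fun k => by
    have h := signRatio_eq_one_two_degenerate (S := 2 * reg.L k + 1) (reg.β k)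
      (reg.mcrit k + reg.a k * t / reg.Zm k)
    have e : (bare reg (fun _ : Fin 2 => t) k) = fun _ : Fin 2 => reg.mcrit k + reg.a k * t / reg.Zm k :=
      rfl
    rw [e, h]
    norm_num

/-! ### §3 Load map of the pinned crux -/

/-- The crux with the pin deleted (otherwise verbatim). -/
def ChiralMobilityGapWithoutPin : Prop :=
  ∀ Nf : ℕ, Nf = 2 ∨ Nf = 3 → ∃ reg : QCDRegularisation Nf, Clauses Nf reg

/-- Deleting the pin gives back EXACTLY the support crux `MobilityGap` (definitional). -/
theorem withoutPin_iff_mobilityGap :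
    ChiralMobilityGapWithoutPin ↔ Summit.QuantumFields.QCD.Theses.WilsonMobilityGap.MobilityGap :=
  Iff.rfl

/-- The crux with clause (iii) LOWER deleted but the pin kept. -/
def ChiralMobilityGapWithoutLower : Prop :=
  ∀ Nf : ℕ, Nf = 2 ∨ Nf = 3 → ∃ reg : QCDRegularisation Nf,
    reg.HasMassScaling ∧ reg.IsChiralAtZero ∧ (reg.scheme 0 0 0).HasAsymptoticScaling ∧
      ∀ m : Fin Nf → ℝ, (∀ f, 0 < m f) → ClauseI reg m ∧ Upper reg m ∧ Sign reg m

/-- **`WithoutLower` minus the pin is the (provable) `MobilityGapWithoutLower` of LowerPin §3**; so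
whatever content `ChiralMobilityGapWithoutLower` has beyond junk enters through the pin alone. -/
theorem withoutLower_imp_mobilityGapWithoutLower (h : ChiralMobilityGapWithoutLower) :
    MobilityGapWithoutLower := by
  intro Nf hNf
  obtain ⟨reg, h1, -, h3, h4⟩ := h Nf hNf
  exact ⟨reg, h1, h3, h4⟩

/-- **Near-miss (sorried; obstruction recorded).**  The lattice-heavy junk witness `heavyReg` of
LowerPin §3 (all realised bare masses `≥ 1`, convergent hopping region) inhabits (i), (ii), (iv) and
both scalings (`mobilityGapWithoutLower_holds`).  Physically it is NOT chiral at zero (a lattice-heavy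
theory is uniformly gapped), so one expects `ChiralMobilityGapWithoutLower` to have no junk witness of
this kind — the pin would then be a SECOND honesty pin, independent of (iii).  But `¬ IsChiralAtZero`
asks for `HasLatticeMassGap ε` for ALL gauge-invariant local observables, including purely GLUONIC
pairs (Wilson loops), whose clustering at `β_k → ∞` is the weak-coupling Yang–Mills mass-gap problem;
and the fermionic pairs need a cluster expansion of the signed functional `qcdTorusExpect` (bounded at
heavy positive masses by Seiler positivity + `‖D⁻¹‖ ≤ 1/m`, but its DECAY again couples to the glue).
Tried: hopping bound `ThickCollarFarStability.stub_hopping` (controls `fm`, not `qcdLatticeConnectedCorr`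
of arbitrary `A, B`).  Conversely `heavyReg` cannot be SHOWN chiral either (that would be false).  So the
status of `ChiralMobilityGapWithoutLower` is open both ways in Lean; informative, not closable. -/
theorem heavyReg_not_chiral (hNf : 0 < Nf) : ¬ (heavyReg Nf).IsChiralAtZero := by
  sorry

/-! ### §4 Natural strengthenings (tried)

(a) TRANSFERRED, refuted: a `k`-uniform LATTICE decay rate in (ii) for the exponent of (iii)
(`eventually_not_latticeRate_of_lower`, LowerPin/Disproof §4) — unchanged by the pin.

(b) NOT refutable here, recorded as tried:
* "(ii) with `δ` uniform in `m ↓ 0`" — with the pin this is physically false (`δ(t) ≤ s m_π(t)/2 → 0`: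
  for `N_f = 2` on the diagonal the pion correlator is `E₊‖G(0,v)‖²_F` configuration-wise by
  `γ₅`-hermiticity, and gaplessness forces its rate to `0`), but a Lean refutation needs the comparison
  `E₊ X² ≲ E₊ X^s` up to sub-exponential factors UNIFORMLY in the volume `S ≥ L_k`, i.e. a Wegner-type tail
  bound `μ_W(‖D⁻¹‖ > λ) ≤ C λ⁻¹` WITHOUT volume factor — not available (the support item `WegnerEstimate`
  is extensive, `∝ L⁴`, and open).
* "the pin along EVERY subsequence / eventually in `k`" — stronger than the crux (`isChiralAtZero_iff_
  frequently`: the pin is a liminf condition); physically true for the honest witness, no handle.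
* "(iv) at ALL volumes `S ≥ L_k`" — physically false at fixed `k` (dilute defect gas, `⟨σ⟩₊ ≈ e^{-2ρV}`),
  needs a LOWER bound on the real-mode density of the interacting measure; unchanged from the unpinned crux.
* "the pin witnessed at tuples `m(ε) → 0`" — NOT implied by the text (`∃ m` per `ε`, any size); a
  regularisation gapless at one fixed tuple for junk reasons (`isChiralAtZero_of_equalTime_unbounded`)
  is chiral at zero.  Statement-quality remark for the planner, not a refutation.
-/

/-! ### §5 Line `Sketch` (lead's PICKED line; card `Ideas/pin-rides-on-lower-clause.md`) — adversarial reading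

The line reduces the pin to the small-mass asymptotics of the (iii) constants: `IsChiralAtZero` follows
from (iii) on DEGENERATE tuples with `inf_t C₁(t)/s(t) = 0` (`N_f = 2`; `N_f = 3` modulo one sign input
at side `2L_k+1`).  Checks made here (no stub broken, nothing posted):
* `N_f = 2` chain: `fm_s ≥ c₀e^{-C₁a n}(n+1)^{-p}` ⇒ (Lyapunov under the phase-quenched PROBABILITY
  measure, landed `isProbabilityMeasure_qcdLatticeMeasure_all`) `E₊[(Σ|G|)²] ≥ fm_s^{2/s}` ⇒
  (`(Σ_{144 entries}|G|)² ≤ 144 Σ|G|² = 144‖G‖²_F`, Cauchy–Schwarz) `E₊‖G(0,ne₀)‖²_F ≥ fm_s^{2/s}/144` ⇒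
  (Wick for the charged pion pair at the degenerate tuple, `det(D_t ⊕ D_t) = det² = ‖det‖`, §2 above, and
  charge-vanishing of `⟨π^±⟩`) `‖qcdLatticeConnectedCorr(π⁺,π⁻,n)‖ ≥ c e^{-(2C₁/s)a_k n}(n+1)^{-2p/s}` on
  every `S ≥ L_k`, `n ≤ S`, eventually in `k` ⇒ `¬HasLatticeMassGap ε` for `ε > 2C₁/s` at ONE large `k`
  with `n = S → ∞` (`no_rate_sandwich`).  Sound: every arrow is an inequality in the cheap direction; the
  only integrability input is `det²(Σ|G|)² ≤ 144 Σ|adj-entries|²`, bounded.  The junk `D⁻¹ := 0` at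
  singular `D` is harmless (weight `det² = 0` there; the Wick identity must be used in its row-replacement
  / adjugate form, as the card says).
* Consequently the pin adds to `MobilityGap` exactly: the BEST (iii)-rate on the diagonal is chiral,
  `inf_t C₁(t)/s(t) = 0` — i.e. `m_crit(k)` is the gap-closing bare mass to `o(a_k/Z_m(k))` along a
  subsequence.  This is consistent with §1: `shiftReg reg M₀` has (iii) with `C₁(t) ↦ C₁(M₀ + t) ↛ 0`.
* `N_f = 3`: the extra sign input ("sign defects carry less than half of the long-distance pion weight at
  side `2L_k+1`") is of the same kind as (iv) and not attackable here (§6).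
-/

/-! ### §6 Why the pinned crux resists a cheap kill (for the provers)

1. EVERYTHING OF `Cruxes/MobilityGap/Disproof.lean` §6 STANDS (junk excluded both ways by (iii); no
   configuration-wise handle — poles of `D⁻¹` are integrable under `|det|`; the physical kill criteria are
   weak-coupling infinite-volume statements no finite computation certifies; no printed counterexample:
   Golterman–Shamir–Svetitsky report LOCALISED near-zero modes outside the Aoki phase, Mohler–Schaefer a
   negative-determinant fraction falling `2% → 0.05%` from `β = 3.4` to `3.7`).
2. THE PIN GIVES THE DISPROVER NOTHING TO HOLD.  It is NEGATIVE information (absence of a uniform gap at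
   some positive tuple per `ε`), usable against the witness only together with a POSITIVE decay statement
   for the SIGNED functional of ALL observables that is UNIFORM in `m ↓ 0` — but (ii) is per-`m`
   (`δ = δ(m)`), phase-quenched, single-entry and fractional; the bridge (ii) ⇒ signed full gap is the
   other two cruxes of the route (K2 `PhaseQuenchedFlavourDecay`, K3 `ChiralGluonicCompletion`) and even
   they conclude at an `m`-dependent rate.  In-Lean CHEAPEST FALSIFIER of the route text ("derive
   `¬IsChiralAtZero` from (i)–(iv) ∀ m > 0 alone") therefore fails for the stated reason: the constants
   sit inside `∀ m`.  Formally: `clauses_shiftReg` shows the unpinned package cannot distinguish a chiral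
   witness from its gapped upward shifts, so NO argument from (i)–(iv) alone can refute the pin.
3. WHAT THE PIN COSTS THE PROVER (quantified).  With `m_crit(k)` ON the chiral line (no offset `M₀`):
   * (iv), `N_f = 3`, degenerate tuple `(t,t,t)`: `sign det = (−1)^{N_<}`, `N_<` = number of real
     eigenvalues of `D_W(U,0,1)` below `|m_crit(k)| − a_k t/Z_m(k)` ("early crossers").  For a dilute gas
     of density `ρ_k` per site, `P₊(N_< odd) ≤ 1/4 ⟺ ρ_k (2L_k+1)⁴ ≲ (log 2)/2`; since `a_k L_k → ∞` is
     the prover's to choose as slowly as desired, the requirement is `ρ_k = o(a_k⁴)` — early crossers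
     must vanish in PHYSICAL units (`4 b₀ S_e > 4`, i.e. dislocation action `S_e > 1/b₀ = 16π²/9 ≈ 17.5`
     for `N_f = 3` in the tree normalisation `β = 2/g₀²`, against the instanton `4π² ≈ 39.5`).  For split
     `N_f = 2` tuples the window has lattice width `a_k|t₁ − t₂|/Z_m(k)`, so the requirement on the
     real-mode DENSITY per unit eigenvalue near threshold is `ρ'_k = o(a_k³ Z_m(k))`.
   * Early crossers at large `k` are NOT the Pugh–Teper dislocations (those have cold-background real
     modes at `λ = O(1) ≫ |m_c(β_k)| → 0`, i.e. they cross LATE); they are objects whose real mode sits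
     BELOW the ensemble's additive shift `|m_c(β_k)| ≈ 4(1 − u₀)`: smooth objects of size `ρ ≳ a/g₀` in
     anomalously cold bubbles (entropic cost `e^{-c(ρ/a)⁴ log β} = e^{-c' β² log β} ≪ e^{-β/b₀}`).  Heuristics
     favour the clause; no printed lower bound on the early-crosser density exists; a refutation of (iv)
     needs `liminf_k P₊,k(odd) > 0` with `L_k` FREE — a defect probability bounded below at fixed physical
     volume uniformly in `k` — for which there is no tool.
   * the pin proper: for `N_f = 2` it is the statement `inf_t C₁(t)/s(t) = 0` about (iii) (§5); for
     `N_f = 3` it additionally needs sign coherence of the long-distance pion weight at side `2L_k+1`.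
4. (ii) IS NOT A LOCALISATION STATEMENT ON THE DIAGONAL (remark for both sides).  With
   `X = Σ_{a,i,b,j}|G_f(0,v)_{ai,bj}|`, Jensen under the phase-quenched probability measure and the landed
   `ℓ¹/ℓ²`–`γ₅` sandwich give `E₊[X^s] ≤ (E₊[X²])^{s/2} ≤ (144 · E₊‖G_f(0,v)‖²_F)^{s/2}`, and
   `E₊‖G_f(0,v)‖²_F` is the phase-quenched charged-"pion" two-point function built from flavour `f` and a
   mass-degenerate partner (exactly the honest `π⁺π⁻` correlator for `N_f = 2` on the diagonal, §2).  Hence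
   (ii) at `(s, δ, C) = (s, s m_π/2, (144 C_π)^{s/2})` FOLLOWS from a volume-uniform bound
   `E₊‖G(0,v)‖²_F ≤ C_π e^{-m_π a_k ‖v‖∞}` — a pion-channel gap of the positive-weight theory (transfer
   matrix in the direction of the largest coordinate of `v`).  So on the diagonal the UPPER clause is the
   EASY direction of "the pion has a physical mass", the fractional-moment dressing adds nothing, and the
   Golterman–Shamir localisation length of zero modes of `H_W` (which diverges at the Aoki boundary) is NOT
   what (ii) measures; conversely the disprover cannot attack (ii) separately from the pion gap.  Off the
   diagonal / for `N_f = 3` the same Jensen step reduces (ii) to decay of `E₊‖G_f‖²_F` under `|Π det|`, a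
   phase-quenched (non-RP) functional — that, and (iii)'s LOWER direction, is where the content sits.
5. COMPUTE: none run (kit allowed).  A toy (exact real modes of `D_W(U,0,1)` on quenched `SU(2)`/`SU(3)`
   `8⁴` at two `β`, histogram of positions relative to `|m_c(β)|`) would estimate the early-crosser
   fraction — evidence for the lead, not a certificate against the crux; deferred to a cycle in which the
   lead asks for it (`disprover-wanted`).
-/

end Summit.QuantumFields.QCD.Cruxes.ChiralMobilityGap.Disproof

end
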